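import Mathlib

/-!
# Scaled form of the absorbing streak / roll-left recurrences and the finite-`ε` quadrupole factor
(kernel #233, lemmaR-A3 §8(w), PLAN §114 — architecture v4 of the regime-(II) inner lemma)

Solo-blind programme, session s91.  In the quadrupole sub-model of the frozen `κ = 0⁺` column operator
(unknowns `s₀, s₁, (s_m, r_m)_{m ≥ 2}`, hopping `h = -i/2`, absorption `ε K₀ m²`, line `z = -γε + i(1 + sc·x)`,
`sc² = ε K₀`, `γ = K₀/2`) the memory kernel factorises through SCALAR objects only:
`Φ(z) = e_{r2}ᵀ 𝔊_r(z) P 𝔊_s(z) q = p(z) · S(z) / (F_s(z) F_r(z))`, where `ψ` is the streak subordinate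
solution, `φ` the roll LEFT subordinate solution, `S = Σ_{m≥2} φ_m ψ_m`, `F_s`, `F_r` their boundary
residuals (Jost functions) and `p(z)` the local quadrupole polynomial of Theorem 3 below.

Theorems 1–2 record the exact bookkeeping behind the continuum limit: writing `ψ_m = (-1)^m σ_m`,
`φ_n = (-1)^n c_n`, the streak row is `(-1)^m h · [δ²σ_m - g²Q_s(m) σ_m]` and `n ×` the transposed roll
row is `(-1)^n h · [n δ²c_n - (c_{n+1} - c_{n-1}) - n g² Q_r(n) c_n]` with
`g² Q_s(m) = 2 sc x + 2i(γ + a₀)ε - 2i ε K₀ m²`, `g² Q_r(n) = 2 sc x + 2i(γ - a₀)ε - 2i ε K₀ n²`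
(`g² = √2·sc` is the squared grid step of `y = m g`; so these are the 3-point schemes for
`σ'' = (√2 x_eff - i y²) σ` and `c'' - (2/y) c' = (√2 x_eff' - i y²) c`, i.e. the parabolic-cylinder
equation and the `ℓ = 1` left-partner equation; note the opposite signs of `a₀`).
Theorem 3: the solution `ψ⁻ = (1, ψ⁻₁, ψ⁻₂, …)` of rows 0 and 1 has `ψ⁻₁ = √2 i (z - εa₀)`,
`ψ⁻₂ = -√2 - 2√2 (z - εa₀ + εK₀)(z - εa₀)`, and the quadrupole datum `q = (-iα/√2) e₀ + (iα/2) e₂`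
pairs with it to `p(z) = q₀ + q₂ ψ⁻₂ = -i√2 α [1 + (z - εa₀ + εK₀)(z - εa₀)]` — the finite-`ε` version of
the factor `-i√2 α (1 + z²)` of kernel #230 (it vanishes to first order at the band edge: `𝒰(0) = 3/2`).
All three are polynomial identities over `ℂ` (using only `I² = -1` and `(√2)² = 2`).
-/

namespace Summit.AnomalousDissipation.AnomalousDissipation.Theorems

open Complex

/-- Theorem 1 (streak row, `m = n+1 ≥ 1`): with `ψ_k = (-1)^k σ_k`, `h = -i/2`, `z = -γε + i(1 + sc x)`,
`(z - εa₀ + εK₀ m²) ψ_m - h (ψ_{m+1} + ψ_{m-1}) = (-1)^m h [ (σ_{m+1} - 2σ_m + σ_{m-1}) - g²Q_s(m) σ_m ]`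
with `g² Q_s(m) = 2 sc x + 2 i (γ + a₀) ε - 2 i ε K₀ m²`. -/
theorem streakRow_scaled (z h ε a0 K0 sc x γ : ℂ) (σ : ℕ → ℂ) (n : ℕ)
    (hh : h = -I / 2) (hz : z = -γ * ε + I * (1 + sc * x)) :
    (z - ε * a0 + ε * K0 * ((n : ℂ) + 1) ^ 2) * ((-1) ^ (n + 1) * σ (n + 1))
      - h * ((-1) ^ (n + 2) * σ (n + 2) + (-1) ^ n * σ n)
    = (-1) ^ (n + 1) * h *
        ((σ (n + 2) - 2 * σ (n + 1) + σ n)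
          - (2 * sc * x + 2 * I * (γ + a0) * ε - 2 * I * (ε * K0) * ((n : ℂ) + 1) ^ 2) * σ (n + 1)) := by
  subst hh hz
  linear_combination ((-1) ^ (n + 1) * σ (n + 1) * (ε * K0 * ((n : ℂ) + 1) ^ 2 - (γ + a0) * ε))
    * Complex.I_sq

/-- Theorem 2 (transposed roll row = column `n = k+1` of `z - J_rr`, multiplied by `n`): with
`φ_j = (-1)^j c_j`, `n (z + εa₀ + εK₀ n²) φ_n - h[(n+1) φ_{n-1} + (n-1) φ_{n+1}]
 = (-1)^n h [ n (c_{n+1} - 2c_n + c_{n-1}) - (c_{n+1} - c_{n-1}) - n g²Q_r(n) c_n ]`,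
`g² Q_r(n) = 2 sc x + 2 i (γ - a₀) ε - 2 i ε K₀ n²` (continuum: `c'' - (2/y) c' = Q c`). -/
theorem rollLeftRow_scaled (z h ε a0 K0 sc x γ : ℂ) (c : ℕ → ℂ) (k : ℕ)
    (hh : h = -I / 2) (hz : z = -γ * ε + I * (1 + sc * x)) :
    ((k : ℂ) + 1) * (z + ε * a0 + ε * K0 * ((k : ℂ) + 1) ^ 2) * ((-1) ^ (k + 1) * c (k + 1))
      - h * ((((k : ℂ) + 1) + 1) * ((-1) ^ k * c k) + (((k : ℂ) + 1) - 1) * ((-1) ^ (k + 2) * c (k + 2)))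
    = (-1) ^ (k + 1) * h *
        (((k : ℂ) + 1) * (c (k + 2) - 2 * c (k + 1) + c k) - (c (k + 2) - c k)
          - ((k : ℂ) + 1) * (2 * sc * x + 2 * I * (γ - a0) * ε - 2 * I * (ε * K0) * ((k : ℂ) + 1) ^ 2)
              * c (k + 1)) := by
  subst hh hz
  linear_combination ((-1) ^ (k + 1) * ((k : ℂ) + 1) * c (k + 1)
      * (ε * K0 * ((k : ℂ) + 1) ^ 2 - (γ - a0) * ε)) * Complex.I_sq

/-- Theorem 3 (local solution of rows 0–1 and the finite-`ε` quadrupole factor).  Rows 0 and 1 of the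
streak block are `(z - εa₀, -h√2, 0, …)` and `(-h√2, z - εa₀ + εK₀, -h, 0, …)`; with `r = √2`,
`ψ⁻ = (1, r i (z - εa₀), -r - 2r(z - εa₀ + εK₀)(z - εa₀), …)` solves both, and the datum
`q = (-iα r/2) e₀ + (iα/2) e₂` gives `q₀ + q₂ ψ⁻₂ = -iα r [1 + (z - εa₀ + εK₀)(z - εa₀)]`. -/
theorem quadrupoleLocalFactor (z h ε a0 K0 α r : ℂ) (hh : h = -I / 2) (hr : r * r = 2) :
    ((z - ε * a0) * 1 + (-h * r) * (r * I * (z - ε * a0)) = 0)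
    ∧ ((-h * r) * 1 + (z - ε * a0 + ε * K0) * (r * I * (z - ε * a0))
        + (-h) * (-r - 2 * r * (z - ε * a0 + ε * K0) * (z - ε * a0)) = 0)
    ∧ ((-I * α * r / 2) * 1 + (I * α / 2) * (-r - 2 * r * (z - ε * a0 + ε * K0) * (z - ε * a0))
        = -I * α * r * (1 + (z - ε * a0 + ε * K0) * (z - ε * a0))) := by
  subst hh
  refine ⟨?_, ?_, ?_⟩
  · linear_combination ((z - ε * a0) * I / 2 * I) * hr + (z - ε * a0) * Complex.I_sq
  · ring
  · ring

end Summit.AnomalousDissipation.AnomalousDissipation.Theorems
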